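import Mathlib.RepresentationTheory.Subrepresentation
import Mathlib.RepresentationTheory.Irreducible
import Mathlib.Order.Atoms
import HarnessLib

/-!
# The socle of a representation

Topic `NumberTheory/Automorphic` (used by the mod `p` representation theory of `GL₂(F)`:
"socle`(π|_{GL₂(𝒪_F)F^×})`", Breuil, ICM 2010, §3.2, Theorem 3.4).

For a representation `ρ : Representation k G V` (Mathlib, unbundled, no topology) we define its
**socle** `Representation.socle ρ : Subrepresentation ρ`, the sum of all irreducible
subrepresentations, where "irreducible subrepresentation" means an atom of the bounded lattice
`Subrepresentation ρ` (a minimal non-zero subrepresentation; for `k` a field this is Mathlib's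
`Representation.IsIrreducible` of the subrepresentation, both being `IsSimpleOrder` conditions).
The `K`-socle of a representation `π` of `G ≥ K` is `(π.comp K.subtype).socle`.

Mathlib has no socle for modules or representations (grep `socle`: nothing); the definition is
the lattice-theoretic one, `⨆ {W | IsAtom W}`, taken in the complete lattice `Submodule k V` and
shown to be `G`-stable.

## Main definitions and statements (all proved)

* `Representation.socle ρ : Subrepresentation ρ`, with carrier `⨆ (W atom), W.toSubmodule`.
* `Representation.le_socle_of_isAtom`: every irreducible subrepresentation lies in the socle.
* `Representation.socle_le_iff`: the socle is the *least* subrepresentation containing all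
  irreducible ones (universal property of the supremum).
* `Representation.socle_eq_top_of_isSimpleOrder`: an irreducible representation is its own socle.

Namespace `Representation`: a deliberate dot-notation extension of a Mathlib namespace (as in
`Literature/NumberTheory/Automorphic/SmoothRepresentation.lean`).

## References

* C. W. Curtis, I. Reiner, *Methods of representation theory* I (1981), §56 (socle of a
  module). [folklore]
* C. Breuil, *The emerging p-adic Langlands programme*, Proc. ICM 2010, Vol. II, §3.2
  (the `GL₂(𝒪_F)F^×`-socle). [cite: Breuil2011, §3.2]
-/

namespace Representation

variable {k G V : Type*} [CommRing k] [Monoid G] [AddCommGroup V] [Module k V]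
  (ρ : Representation k G V)

/-- The carrier of the socle: the supremum, in `Submodule k V`, of the irreducible (= atomic)
subrepresentations of `ρ`. [folklore] -/
def socleSubmodule : Submodule k V :=
  ⨆ W : {W : Subrepresentation ρ // IsAtom W}, (W : Subrepresentation ρ).toSubmodule

/-- The socle carrier is `G`-stable: `ρ g` maps each irreducible subrepresentation into itself. [folklore] -/
theorem apply_mem_socleSubmodule (g : G) {v : V} (hv : v ∈ ρ.socleSubmodule) :
    ρ g v ∈ ρ.socleSubmodule := by
  have hle : (ρ.socleSubmodule).map (ρ g) ≤ ρ.socleSubmodule := by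
    rw [socleSubmodule, Submodule.map_iSup]
    refine iSup_mono fun W => ?_
    rintro _ ⟨w, hw, rfl⟩
    exact (W : Subrepresentation ρ).apply_mem_toSubmodule g hw
  exact hle (Submodule.mem_map_of_mem hv)

/-- The **socle** of a representation: the sum of all its irreducible subrepresentations (atoms of
the lattice `Subrepresentation ρ`), as a subrepresentation.  The `K`-socle of a representation
`π` of a group `G ≥ K` (e.g. `soc_{GL₂(𝒪_F)F^×} π`, Breuil ICM 2010, Thm. 3.4) is
`(π.comp K.subtype).socle`. (Curtis–Reiner I, §56.) [folklore] -/
def socle : Subrepresentation ρ where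
  toSubmodule := ρ.socleSubmodule
  apply_mem_toSubmodule g _ hv := ρ.apply_mem_socleSubmodule g hv

/-- Unfolding: the socle is the supremum of the atomic subrepresentations. [folklore] -/
theorem socle_toSubmodule :
    ρ.socle.toSubmodule =
      ⨆ W : {W : Subrepresentation ρ // IsAtom W}, (W : Subrepresentation ρ).toSubmodule :=
  rfl

/-- Every irreducible (atomic) subrepresentation is contained in the socle. [folklore] -/
theorem le_socle_of_isAtom {W : Subrepresentation ρ} (hW : IsAtom W) : W ≤ ρ.socle := by
  change W.toSubmodule ≤ ρ.socle.toSubmodule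
  rw [socle_toSubmodule]
  exact le_iSup (fun W : {W : Subrepresentation ρ // IsAtom W} =>
    (W : Subrepresentation ρ).toSubmodule) ⟨W, hW⟩

/-- The socle is the least subrepresentation containing every irreducible subrepresentation. [folklore] -/
theorem socle_le_iff {W' : Subrepresentation ρ} :
    ρ.socle ≤ W' ↔ ∀ W : Subrepresentation ρ, IsAtom W → W ≤ W' := by
  constructor
  · exact fun h W hW => (ρ.le_socle_of_isAtom hW).trans h
  · intro h
    change ρ.socle.toSubmodule ≤ W'.toSubmodule
    rw [socle_toSubmodule]
    exact iSup_le fun W => h W W.2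

/-- The socle of an irreducible representation (`Subrepresentation ρ` a simple order, i.e.
Mathlib's `ρ.IsIrreducible` over a field) is everything: `⊤` is then an atom. [folklore] -/
theorem socle_eq_top_of_isSimpleOrder [IsSimpleOrder (Subrepresentation ρ)] : ρ.socle = ⊤ :=
  top_le_iff.1 (ρ.le_socle_of_isAtom isAtom_top)

/-- A representation without irreducible subrepresentations (e.g. on the zero module) has zero
socle. [folklore] -/
theorem socle_eq_bot_of_forall_not_isAtom (h : ∀ W : Subrepresentation ρ, ¬ IsAtom W) :
    ρ.socle = ⊥ :=
  le_bot_iff.1 ((ρ.socle_le_iff).2 fun W hW => (h W hW).elim)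

end Representation
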